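import Summits.BirchSwinnertonDyer.BirchSwinnertonDyer.Theorems.PrintCFramJZeroThreeTraceForm
import Summits.BirchSwinnertonDyer.BirchSwinnertonDyer.Theorems.PrintCFramJZeroThreeUnitRegimePsiPrime
import Summits.BirchSwinnertonDyer.BirchSwinnertonDyer.Theorems.PrintCFramJZeroThreeUnitRegimeHeegnerPrime
import Summits.BirchSwinnertonDyer.Rank1Residual.X12.O11.RouteUBernoulliD11
import HarnessLib

/-! # K12r@3 — the «3-unit regime» at `p = 3`, INSTANCE `ψ = (·/5)`, `K = ℚ(√−11)`: the two
# Bernoulli-unit CERTIFICATES (`B_{1,χ₅χ₁₁}` at level `55`, `B_{1,χ₅ω}` at level `15`), the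
# Kronecker character `ε_K = (·/11)↑` and the binder `hB` of Kriz–Li Thm. 1.20 — for the classes
# `225a, 675a, 6075a, 6075b, 6075c` (Mordell coefficient `5·m²`, Heegner field `d_K = −11`) of
# P3-UNIT-REGIME-CENSUS (cell `bsd-print-cfram`, seat p3 g1; crux C1, stmt-BirchSwinnertonDyer-20371)

HONEST FRAMING (cell `bsd-print-cfram`, run/shared/lean/pub/bsd-print-cfram/, D-0131 (2) print
tier; verbatim in every file of the cell): the cell works the partition leaf
`CornerF ∧ p ramified in the CM field K` (LADDER-BSD row K7r = B13; W-ALL row 12r) in PARTITION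
currency — a leaf or a cell counts only when its theorem is in the kernel BY NAME. Nothing here is a
Literature statement, no named fact is introduced, nothing is asserted about BSD; beyond-print: NO
(two finite certificates, `decide`). Pattern = bsd-cm's `RouteUBernoulliD11` (`p = 7`, `D = −11`,
`d'' = −19`) at `p = 3`: here `ψ = χ₅ = (·/5)` (EVEN, conductor `5`, `ψ(3) = (3/5) = −1`: KL (1)),
`K = ℚ(√−11)` (`3`, `5` split), `ε_K = (·/11)`, `ω` ANY Teichmüller character mod `3` (it is the
Legendre character mod `3`, `PrintCFram.teichmuller_three_apply_of_emod_eq_one/_two`):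
* `θ₁ = ψ⁻¹↑·ε_K↑` has level `55` (prime to `3`), values `(j/5)(j/11)`; certificate
  `S₁ = Σ_{j<55} (j/5)(j/11)·j = −220`, `3 ∤ S₁` (`norm_generalizedBernoulli_theta1_five_eleven`,
  via `PrintCFram.norm_generalizedBernoulli_one_eq_one_of_intCert`).
* `θ₂ = ψ↑·ω⁻¹↑` has level `15`, values `(j/5)(j/3)` EXACTLY; certificate `S₂ = Σ_{j<15} (j/5)(j/3)·j
  = −30`, `3 ∥ S₂` (`norm_generalizedBernoulli_theta2_five`, via bsd-cm's
  `RouteU.norm_generalizedBernoulli_one_eq_one_of_cert` with exponent `0`).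
* `bernoulli_hypothesis_five_eleven` — the binder `hB` of `JZeroThree.bsdp_three_of_thm120_unitRegime`
  for `(ψ, ε_K, ω) = ((·/5), (·/11)↑, ω)`; `isKroneckerCharacterOf_eleven` — the binder `hεK` for a
  number field `K` with `[K:ℚ] = 2`, `d_K = −11`; `exists_legendreCharacter_three` — the characters
  exist (Mathlib `quadraticChar`).
References: [KrizLi2019] Thm. 1.20 (p. 8), §1.5 (1); [Washington1997] §5.1, Thm. 4.2;
`X12/O11/RouteUBernoulliD11.lean` (bsd-cm).
-/

set_option linter.dupNamespace false
set_option autoImplicit false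

noncomputable section

open scoped Classical
open NumberField DirichletCharacter Literature.NumberTheory.EllipticCurves.KrizLi2019
  Literature.NumberTheory.LFunctions
  Summit.BirchSwinnertonDyer.Rank1Residual.X12.O11.RouteU

namespace Summit.BirchSwinnertonDyer.BirchSwinnertonDyer.Theorems.PrintCFram

/-- `5` is prime (global instance for `decide`/`legendreSym`). [folklore] -/
instance fact_prime_five_psi5 : Fact (Nat.Prime 5) := ⟨by norm_num⟩

/-- `3` is prime. [folklore] -/
instance fact_prime_three_psi5 : Fact (Nat.Prime 3) := ⟨Nat.prime_three⟩

/-! ## §0 Existence of the Legendre characters with values in `ℚ₃`; `ω` mod `3` is `(·/3)` -/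

/-- **The Legendre character mod an odd prime `q` as a `ℚ₃`-valued Dirichlet character exists**
(Mathlib's `quadraticChar (ZMod q)` composed with `ℤ → ℚ₃`). [folklore] -/
theorem exists_legendreCharacter_three (q : ℕ) [Fact q.Prime] :
    ∃ χ : DirichletCharacter ℚ_[3] q, ∀ a : ℕ, χ (a : ZMod q) = (legendreSym q (a : ℤ) : ℚ_[3]) :=
  ⟨(quadraticChar (ZMod q)).ringHomComp (Int.castRingHom ℚ_[3]), fun a => by
    rw [MulChar.ringHomComp_apply, legendreSym, Int.cast_natCast]; rfl⟩

/-- **A Teichmüller character mod `3` is the Legendre character mod `3`**: `ω(a) = (a/3)` for every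
`a ∈ ℕ` (`ω(a) = ±1` by `a mod 3`, `PrintCFram.teichmuller_three_apply_of_emod_eq_one/_two`; both
vanish at `3 ∣ a`). [cite: Washington1997, §5.1 (the Teichmüller character)] -/
theorem teichmuller_three_apply_eq_legendreSym {ω : DirichletCharacter ℚ_[3] 3}
    (hω : IsTeichmullerCharacter ω) (a : ℕ) : ω (a : ZMod 3) = (legendreSym 3 (a : ℤ) : ℚ_[3]) := by
  rw [legendreSym_eq_ite 3 (by norm_num)]
  by_cases h0 : ((a : ℤ) : ZMod 3) = 0
  · rw [if_pos h0]
    have : (a : ZMod 3) = 0 := by exact_mod_cast h0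
    rw [this, MulChar.map_zero, Int.cast_zero]
  · rw [if_neg h0]
    have ha3 : ¬ (3 ∣ a) := fun h => h0 (by
      rw [Int.cast_natCast]; exact (ZMod.natCast_eq_zero_iff a 3).mpr h)
    rcases (show a % 3 = 1 ∨ a % 3 = 2 by omega) with h1 | h2
    · have hω1 := teichmuller_three_apply_of_emod_eq_one hω (a : ℤ) (by exact_mod_cast h1)
      rw [Int.cast_natCast] at hω1
      have hsq : ((a : ℤ) : ZMod 3) ^ (3 / 2) = 1 := by
        have : ((a : ℤ) : ZMod 3) = 1 := by
          rw [Int.cast_natCast]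
          rw [show (1 : ZMod 3) = ((1 : ℕ) : ZMod 3) by rfl, ZMod.natCast_eq_natCast_iff']
          simpa using h1
        rw [this]; norm_num
      rw [hω1, if_pos hsq, Int.cast_one]
    · have hω2 := teichmuller_three_apply_of_emod_eq_two hω (a : ℤ) (by exact_mod_cast h2)
      rw [Int.cast_natCast] at hω2
      have hsq : ((a : ℤ) : ZMod 3) ^ (3 / 2) ≠ 1 := by
        have : ((a : ℤ) : ZMod 3) = 2 := by
          rw [Int.cast_natCast]
          rw [show (2 : ZMod 3) = ((2 : ℕ) : ZMod 3) by rfl, ZMod.natCast_eq_natCast_iff']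
          simpa using h2
        rw [this]; decide
      rw [hω2, if_neg hsq]
      norm_num

/-- `ω⁻¹ = ω` for a Teichmüller character mod `3` (its values are `±1`). [cite: Washington1997, §5.1] -/
theorem teichmuller_three_inv_eq {ω : DirichletCharacter ℚ_[3] 3} (hω : IsTeichmullerCharacter ω) :
    ω⁻¹ = ω := by
  have h2 : ω * ω = 1 := by
    refine MulChar.ext fun u => ?_
    have hu : ((u : ZMod 3)) = (((u : ZMod 3).val : ℕ) : ZMod 3) := (ZMod.natCast_zmod_val _).symm
    have hu0 : ((((u : ZMod 3).val : ℕ) : ℤ) : ZMod 3) ≠ 0 := by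
      rw [Int.cast_natCast, ZMod.natCast_zmod_val]; exact Units.ne_zero u
    rw [MulChar.mul_apply, MulChar.one_apply_coe, hu, teichmuller_three_apply_eq_legendreSym hω,
      ← Int.cast_mul, ← sq, legendreSym.sq_one 3 hu0, Int.cast_one]
  exact inv_eq_of_mul_eq_one_right h2

/-! ## §1 `θ₁ = χ₅χ₁₁` at level `55`: primitive, `‖B_{1,θ₁}‖₃ = 1` -/

section ThetaOne

variable (χ₅ : DirichletCharacter ℚ_[3] 5) (χ₁₁ : DirichletCharacter ℚ_[3] 11)
  (h₅ : ∀ a : ℕ, χ₅ (a : ZMod 5) = (legendreSym 5 (a : ℤ) : ℚ_[3]))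
  (h₁₁ : ∀ a : ℕ, χ₁₁ (a : ZMod 11) = (legendreSym 11 (a : ℤ) : ℚ_[3]))

include h₅ h₁₁

/-- Values of `θ₁ = χ₅⁻¹↑·χ₁₁↑` at level `55`: `θ₁(j) = (j/5)(j/11)` (both sides vanish off the
units). [cite: KrizLi2019, §2 (p. 11)] -/
theorem thetaOne_five_eleven_apply (j : ZMod 55) :
    (changeLevel (dvd_mul_right 5 11) χ₅⁻¹ * changeLevel (dvd_mul_left 11 5) χ₁₁ :
      DirichletCharacter ℚ_[3] (5 * 11)) j =
      ((legendreSym 5 (j.val : ℤ) * legendreSym 11 (j.val : ℤ) : ℤ) : ℚ_[3]) := by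
  have hinv : χ₅⁻¹ = χ₅ := inv_eq_of_mul_eq_one_right (legendreChar_three_mul_self χ₅ h₅)
  have hj : ((j.val : ℤ) : ZMod (5 * 11)) = j := by rw [Int.cast_natCast, ZMod.natCast_zmod_val]
  rw [hinv]
  by_cases hu : IsCoprime (j.val : ℤ) ((5 * 11 : ℕ) : ℤ)
  · conv_lhs => rw [← hj]
    rw [MulChar.mul_apply, changeLevel_eq_cast_of_dvd' _ _ hu, changeLevel_eq_cast_of_dvd' _ _ hu,
      Int.cast_natCast, Int.cast_natCast, h₅, h₁₁, Int.cast_mul]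
  · have hnu : ¬ IsUnit j := by
      rw [← hj, ZMod.coe_int_isUnit_iff_isCoprime]; exact fun h => hu (by simpa [isCoprime_comm] using h)
    rw [MulChar.map_nonunit _ hnu]
    have h55 : ¬ (j.val).Coprime (5 * 11) := fun h => hu (Nat.isCoprime_iff_coprime.mpr h)
    rw [Nat.coprime_mul_iff_right, not_and_or] at h55
    rcases h55 with h5 | h11
    · have hd : 5 ∣ j.val := by
        rwa [Nat.coprime_comm, Nat.Prime.coprime_iff_not_dvd (by norm_num), not_not] at h5
      rw [(legendreSym.eq_zero_iff 5 _).mpr (by rw [Int.cast_natCast]; exact (ZMod.natCast_eq_zero_iff _ _).mpr hd)]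
      simp
    · have hd : 11 ∣ j.val := by
        rwa [Nat.coprime_comm, Nat.Prime.coprime_iff_not_dvd (by norm_num), not_not] at h11
      rw [(legendreSym.eq_zero_iff 11 _).mpr (by rw [Int.cast_natCast]; exact (ZMod.natCast_eq_zero_iff _ _).mpr hd)]
      simp

/-- **`θ₁ = χ₅⁻¹↑·χ₁₁↑` is PRIMITIVE of conductor `55`.** [cite: Washington1997, Ch. 3] -/
theorem thetaOne_five_eleven_isPrimitive :
    (changeLevel (dvd_mul_right 5 11) χ₅⁻¹ * changeLevel (dvd_mul_left 11 5) χ₁₁ :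
      DirichletCharacter ℚ_[3] (5 * 11)).IsPrimitive := by
  have hc5 : χ₅⁻¹.conductor = 5 := by
    rw [conductor_inv, conductor_eq_of_prime_of_ne_one χ₅ (legendreChar_three_ne_one χ₅ h₅ (by norm_num))]
  have hc11 : χ₁₁.conductor = 11 :=
    conductor_eq_of_prime_of_ne_one χ₁₁ (legendreChar_three_ne_one χ₁₁ h₁₁ (by norm_num))
  rw [isPrimitive_def, conductor_changeLevel_mul_changeLevel _ _ χ₅⁻¹ χ₁₁ (by rw [hc5, hc11]; norm_num),
    hc5, hc11]

set_option maxRecDepth 20000 in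
/-- **CERTIFICATE 1: `‖B_{1,θ₁}‖₃ = 1` for `θ₁ = χ₅χ₁₁` (level `55`, prime to `3`)**:
`S₁ = Σ_{j<55} (j/5)(j/11)·j` is not divisible by `3` (`decide`; `S₁ = −220 = 55·B_{1,χ_{−55}}`,
`h(−55) = 4`). [cite: KrizLi2019, Thm. 1.20 (p. 8) and §1.5 (1)] [cite: Washington1997, Thm. 4.2] -/
theorem norm_generalizedBernoulli_thetaOne_five_eleven :
    ‖generalizedBernoulli 1 (changeLevel (dvd_mul_right 5 11) χ₅⁻¹ *
        changeLevel (dvd_mul_left 11 5) χ₁₁ : DirichletCharacter ℚ_[3] (5 * 11))‖ = 1 := by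
  have hθ1 : (changeLevel (dvd_mul_right 5 11) χ₅⁻¹ * changeLevel (dvd_mul_left 11 5) χ₁₁ :
      DirichletCharacter ℚ_[3] (5 * 11)) ≠ 1 := by
    intro h1
    have hv := thetaOne_five_eleven_apply χ₅ χ₁₁ h₅ h₁₁ ((54 : ℕ) : ZMod 55)
    have hu : IsUnit ((54 : ℕ) : ZMod (5 * 11)) := by decide
    rw [h1, MulChar.one_apply hu, ZMod.val_natCast] at hv
    have hL : legendreSym 5 ((54 % 55 : ℕ) : ℤ) * legendreSym 11 ((54 % 55 : ℕ) : ℤ) = -1 := by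
      rw [legendreSym_eq_ite 5 (by norm_num), legendreSym_eq_ite 11 (by norm_num)]; decide
    rw [hL] at hv
    norm_num at hv
  refine norm_generalizedBernoulli_one_eq_one_of_intCert _ hθ1 (by norm_num)
    (fun j => legendreSym 5 (j.val : ℤ) * legendreSym 11 (j.val : ℤ))
    (fun j => thetaOne_five_eleven_apply χ₅ χ₁₁ h₅ h₁₁ j) ?_
  rw [sum_univ_zmod_eq_sum_range (fun q => legendreSym 5 (q : ℤ) * legendreSym 11 (q : ℤ) * (q : ℤ))]
  simp_rw [legendreSym_eq_ite 5 (by norm_num), legendreSym_eq_ite 11 (by norm_num)]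
  decide +kernel

end ThetaOne

/-! ## §2 `θ₂ = χ₅ω` at level `15`: primitive, `‖B_{1,θ₂}‖₃ = 1` -/

section ThetaTwo

variable (χ₅ : DirichletCharacter ℚ_[3] 5) (ω : DirichletCharacter ℚ_[3] 3)
  (h₅ : ∀ a : ℕ, χ₅ (a : ZMod 5) = (legendreSym 5 (a : ℤ) : ℚ_[3])) (hω : IsTeichmullerCharacter ω)

include h₅ hω

/-- Values of `θ₂ = χ₅↑·ω⁻¹↑` at level `15`: `θ₂(j) = (j/5)(j/3)` EXACTLY (`ω⁻¹ = ω = (·/3)`).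
[cite: KrizLi2019, §2 (p. 11)] -/
theorem thetaTwo_five_apply (j : ZMod 15) :
    (changeLevel (dvd_mul_right 5 3) χ₅ * changeLevel (dvd_mul_left 3 5) ω⁻¹ :
      DirichletCharacter ℚ_[3] (5 * 3)) j =
      ((legendreSym 5 (j.val : ℤ) * legendreSym 3 (j.val : ℤ) : ℤ) : ℚ_[3]) := by
  have hj : ((j.val : ℤ) : ZMod (5 * 3)) = j := by rw [Int.cast_natCast, ZMod.natCast_zmod_val]
  rw [teichmuller_three_inv_eq hω]
  by_cases hu : IsCoprime (j.val : ℤ) ((5 * 3 : ℕ) : ℤ)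
  · conv_lhs => rw [← hj]
    rw [MulChar.mul_apply, changeLevel_eq_cast_of_dvd' _ _ hu, changeLevel_eq_cast_of_dvd' _ _ hu,
      Int.cast_natCast, Int.cast_natCast, h₅, teichmuller_three_apply_eq_legendreSym hω, Int.cast_mul]
  · have hnu : ¬ IsUnit j := by
      rw [← hj, ZMod.coe_int_isUnit_iff_isCoprime]; exact fun h => hu (by simpa [isCoprime_comm] using h)
    rw [MulChar.map_nonunit _ hnu]
    have h15 : ¬ (j.val).Coprime (5 * 3) := fun h => hu (Nat.isCoprime_iff_coprime.mpr h)
    rw [Nat.coprime_mul_iff_right, not_and_or] at h15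
    rcases h15 with h5 | h3
    · have hd : 5 ∣ j.val := by
        rwa [Nat.coprime_comm, Nat.Prime.coprime_iff_not_dvd (by norm_num), not_not] at h5
      rw [(legendreSym.eq_zero_iff 5 _).mpr (by rw [Int.cast_natCast]; exact (ZMod.natCast_eq_zero_iff _ _).mpr hd)]
      simp
    · have hd : 3 ∣ j.val := by
        rwa [Nat.coprime_comm, Nat.Prime.coprime_iff_not_dvd (by norm_num), not_not] at h3
      rw [(legendreSym.eq_zero_iff 3 _).mpr (by rw [Int.cast_natCast]; exact (ZMod.natCast_eq_zero_iff _ _).mpr hd)]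
      simp

/-- **`θ₂ = χ₅↑·ω⁻¹↑` is PRIMITIVE of conductor `15`.** [cite: Washington1997, Ch. 3] -/
theorem thetaTwo_five_isPrimitive :
    (changeLevel (dvd_mul_right 5 3) χ₅ * changeLevel (dvd_mul_left 3 5) ω⁻¹ :
      DirichletCharacter ℚ_[3] (5 * 3)).IsPrimitive := by
  have hc5 : χ₅.conductor = 5 :=
    conductor_eq_of_prime_of_ne_one χ₅ (legendreChar_three_ne_one χ₅ h₅ (by norm_num))
  have hc3 : ω⁻¹.conductor = 3 := by
    rw [conductor_inv]
    exact conductor_eq_of_prime_of_ne_one ω (ne_one_of_isTeichmullerCharacter (by norm_num) hω)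
  rw [isPrimitive_def, conductor_changeLevel_mul_changeLevel _ _ χ₅ ω⁻¹ (by rw [hc5, hc3]; norm_num),
    hc5, hc3]

set_option maxRecDepth 20000 in
/-- **CERTIFICATE 2: `‖B_{1,θ₂}‖₃ = 1` for `θ₂ = χ₅ω` (level `15`, `3 ∥ 15`)**:
`S₂ = Σ_{j<15} (j/5)(j/3)·j = −30`, `3 ∥ S₂` (`decide`; `B_{1,θ₂} = −2`, `h(−15) = 2`) — bsd-cm's
certificate `RouteU.norm_generalizedBernoulli_one_eq_one_of_cert` with exponent `0` (exact values).
[cite: KrizLi2019, Thm. 1.20 (p. 8) and §1.5 (1)] [cite: Washington1997, Thm. 4.2] -/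
theorem norm_generalizedBernoulli_thetaTwo_five :
    ‖generalizedBernoulli 1 (changeLevel (dvd_mul_right 5 3) χ₅ *
        changeLevel (dvd_mul_left 3 5) ω⁻¹ : DirichletCharacter ℚ_[3] (5 * 3))‖ = 1 := by
  have hθ1 : (changeLevel (dvd_mul_right 5 3) χ₅ * changeLevel (dvd_mul_left 3 5) ω⁻¹ :
      DirichletCharacter ℚ_[3] (5 * 3)) ≠ 1 := by
    intro h1
    have hv := thetaTwo_five_apply χ₅ ω h₅ hω ((14 : ℕ) : ZMod 15)
    have hu : IsUnit ((14 : ℕ) : ZMod (5 * 3)) := by decide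
    rw [h1, MulChar.one_apply hu, ZMod.val_natCast] at hv
    have hL : legendreSym 5 ((14 % 15 : ℕ) : ℤ) * legendreSym 3 ((14 % 15 : ℕ) : ℤ) = -1 := by
      rw [legendreSym_eq_ite 5 (by norm_num), legendreSym_eq_ite 3 (by norm_num)]; decide
    rw [hL] at hv
    norm_num at hv
  have h15 : padicValNat 3 (5 * 3) = 1 := by
    rw [show (5 * 3 : ℕ) = 3 ^ 1 * 5 by norm_num, padicValNat.mul (by norm_num) (by norm_num),
      padicValNat.prime_pow, padicValNat.eq_zero_of_not_dvd (by norm_num)]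
  refine norm_generalizedBernoulli_one_eq_one_of_cert _ hθ1 h15
    (fun j => legendreSym 5 (j.val : ℤ) * legendreSym 3 (j.val : ℤ)) 0 (fun j => ?_) ?_ ?_
  · rw [thetaTwo_five_apply χ₅ ω h₅ hω j, pow_zero, mul_one, sub_self, norm_zero]
    positivity
  · rw [sum_univ_zmod_eq_sum_range (fun q => legendreSym 5 (q : ℤ) * legendreSym 3 (q : ℤ) * (q : ℤ) ^ (0 + 1))]
    simp_rw [legendreSym_eq_ite 5 (by norm_num), legendreSym_eq_ite 3 (by norm_num)]
    decide +kernel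
  · rw [sum_univ_zmod_eq_sum_range (fun q => legendreSym 5 (q : ℤ) * legendreSym 3 (q : ℤ) * (q : ℤ) ^ (0 + 1))]
    simp_rw [legendreSym_eq_ite 5 (by norm_num), legendreSym_eq_ite 3 (by norm_num)]
    decide +kernel

end ThetaTwo

/-! ## §3 `hεK` and `hB` for `(ψ, K) = ((·/5), ℚ(√−11))` -/

/-- **`hεK` for `d_K = −11`**: for a quadratic field `K` with `d_K = −11` and `χ₁₁` the `ℚ₃`-valued
Legendre character mod `11`, `changeLevel (11 ∣ |d_K|) χ₁₁` is the Kronecker character of `K`.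
[cite: KrizLi2019, §2 (p. 12)] [cite: Cox2013, §1.C Lemma 1.14] -/
theorem isKroneckerCharacterOf_eleven {K : Type} [Field K] [NumberField K]
    (hK2 : Module.finrank ℚ K = 2) (hdK : NumberField.discr K = -11)
    (χ₁₁ : DirichletCharacter ℚ_[3] 11)
    (h₁₁ : ∀ a : ℕ, χ₁₁ (a : ZMod 11) = (legendreSym 11 (a : ℤ) : ℚ_[3]))
    (h : 11 ∣ (NumberField.discr K).natAbs) :
    IsKroneckerCharacterOf K (changeLevel h χ₁₁) :=
  isKroneckerCharacterOf_three_changeLevel_jacobi hK2 (m := 11) (by norm_num)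
    (by rw [hdK]; norm_num) χ₁₁ (legendreChar_three_isPrimitive χ₁₁ h₁₁ (by norm_num))
    (fun a => by rw [h₁₁, jacobiSym.legendreSym.to_jacobiSym]) h

/-- **`hB` for `(ψ, ε_K, ω) = ((·/5), (·/11)↑, ω)`**: the Bernoulli hypothesis of Kriz–Li Thm. 1.20
at `p = 3` — `¬ ‖B_{1,ψ₀⁻¹ε_K} · B_{1,ψ₀ω⁻¹}‖₃ ≤ 3⁻¹` — from the two certificates above
(`PrintCFram.bernoulli_hypothesis_three_of_even`; `ψ = (·/5)` is even). `D = |d_K|` is any level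
divisible by `11` (in the application `D = |d_K| = 11`). [cite: KrizLi2019, Thm. 1.20 (p. 8, the Bernoulli hypothesis)] -/
theorem bernoulli_hypothesis_five_eleven {D : ℕ} [NeZero D] (h : 11 ∣ D)
    (χ₅ : DirichletCharacter ℚ_[3] 5) (h₅ : ∀ a : ℕ, χ₅ (a : ZMod 5) = (legendreSym 5 (a : ℤ) : ℚ_[3]))
    (χ₁₁ : DirichletCharacter ℚ_[3] 11)
    (h₁₁ : ∀ a : ℕ, χ₁₁ (a : ZMod 11) = (legendreSym 11 (a : ℤ) : ℚ_[3]))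
    (ω : DirichletCharacter ℚ_[3] 3) (hω : IsTeichmullerCharacter ω) :
    ¬ (‖bernoulliOnePrim (bernoulliCharOne χ₅ (changeLevel h χ₁₁)) *
        bernoulliOnePrim (bernoulliCharTwo χ₅ (changeLevel h χ₁₁) ω)‖ ≤ ((3 : ℕ) : ℝ)⁻¹) := by
  haveI : NeZero (11 : ℕ) := ⟨by norm_num⟩
  have hev : χ₅.Even := by
    show χ₅ (-1) = 1
    have hL : legendreSym 5 ((4 : ℕ) : ℤ) = 1 := by
      rw [legendreSym_eq_ite 5 (by norm_num)]; decide
    rw [show (-1 : ZMod 5) = ((4 : ℕ) : ZMod 5) by decide, h₅, hL, Int.cast_one]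
  exact bernoulli_hypothesis_three_of_even χ₅ hev χ₁₁ h ω
    (thetaOne_five_eleven_isPrimitive χ₅ χ₁₁ h₅ h₁₁)
    (norm_generalizedBernoulli_thetaOne_five_eleven χ₅ χ₁₁ h₅ h₁₁)
    (thetaTwo_five_isPrimitive χ₅ ω h₅ hω) (norm_generalizedBernoulli_thetaTwo_five χ₅ ω h₅ hω)

end Summit.BirchSwinnertonDyer.BirchSwinnertonDyer.Theorems.PrintCFram

end
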